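import Mathlib
import Summits.ResolutionOfSingularities.ResolutionOfSingularities.Theses.Descent
import Literature.AlgebraicGeometry.Resolution.DiscreteSeparableResidueLocalUniformization
import Literature.AlgebraicGeometry.Resolution.RootAdjunctionRegular
import HarnessLib

/-!
# Generic inert projection — a regular (non-smooth) Dedekind–Kummer layer for rung 1
`DiscreteInseparableResidueLU` (lens-3 g7 sketch for crux `DescentPerfectToAll`,
item stmt-ResolutionOfSingularities-0549; sub-line of the registered line
`Lines/valuative_constant_step.lean`; NOT a registered skeleton; counted 0 — nothing here proves
resolution of singularities in characteristic `p`).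

RUNG 1 (verbatim from `Lines/valuative_constant_step.lean`): relative local uniformization over an
imperfect ground field `k` at a DISCRETE rank-one place `O` of `K/k` whose residues are purely
inseparable over `k` (dense constants) and not all in `k`.

LEVER (g7). For DISCRETE `O`, rung 1 only asks for ONE regular algebraic local ring of `K` dominated
by `O` (the quadratic sequence along a discrete zero-dimensional valuation exhausts `O`;
`RegularCatchAlongDiscrete`). Build it by a GENERIC SEPARABLE PROJECTION plus ONE INERT LAYER:
(1) a separating transcendence basis `(x, t₁, …, t_{d-1}) ⊆ O` led by a uniformizer `x` with
prescribed residues `t̄ᵢ = b̄ᵢ`, so that `F = k(x,t)` is rational, `K/F` finite separable with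
`e = 1`, and the residue extension `κ(O) / κ(O ∩ F)` is SIMPLE (`NarrowSeparableProjection`);
(2) by CRT in the (finite, semilocal Dedekind) integral closure of the DVR `R = O ∩ F` and a
primitive-element perturbation, an integral primitive `y` whose minimal polynomial `μ ∈ R[X]`
reduces to `μ̄ = Ḡ · X^m` with `Ḡ = minpoly(θ̄)` IRREDUCIBLE and PRIME TO `X` — the multiplicity of
`Ḡ` is `e·f/deg Ḡ = 1` by `μ̄ = ∏_w g_w^{e_w f_w / deg g_w}` (char-poly of `y` on `R̃/πR̃`)
(`DedekindKummerSeparator`); (3) on a regular model `S_j ⊇ R`-coefficients of `F` along `v|F`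
(`RegularCatchAlongDiscrete`) the ring `A = S_j[X]/(μ)` localized at the centre `𝔮 = (𝔪_{S_j}, G)`
has FIELD fibre `κ(S_j)[X]/(Ḡ)`, so `𝔮A_𝔮 = 𝔪_{S_j}A_𝔮` on `dim S_j` generators and `A_𝔮` is
REGULAR (not smooth: `Ḡ` is inseparable) (`FieldFibreRegular`); (4) `Frac A = K`, `A ⊆ O`.
SCOPE: `K/k` separably generated and the residue field NARROW (generated over `k` by the residues of
`≤ trdeg K` elements) — every simple residue field of any exponent / constant-step type, uniformly,
with NO named fact. Residual cells typed below (`WideOrInfiniteResidueDiscreteLU`,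
`NonSepGenDiscreteLU`); `rung_split` is kernel-checked.

Sources: Abhyankar 1959 (Ramification-theoretic methods) §17 Thm 4.9 / Prop 4.10 (projection +
CRT-separated integral element + quadratic transforms + splitting field; `k` alg. closed, char 0);
Kuhlmann 1999 (arXiv:math/9903097) Thm 1.8 / Thm 1.14; Knaf–Kuhlmann 2009 (arXiv:math/0702856)
Thm 1.5 / Thm 1.6 (smooth uniformizability forces separable residue extension — our models are
regular, not smooth: Disproof.lean §10 honoured); Cutkosky–Mourtada 2019 (arXiv:1711.02726) §7
(defectless projections, `k` alg. closed); tree: `stub_kummerCriterion`,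
`isRegularLocalRing_of_forall_not_mem` (inert Kummer case = `FieldFibreRegular` with `μ = X^p - a`,
`m = 0`), `AdjoinRoot.isRegularLocalRing_X_pow_sub_C`, `stub_uniformizer_separating`
(AbhyankarShadows, perfect ground field).
-/

noncomputable section

set_option linter.dupNamespace false

open Literature.AlgebraicGeometry.Resolution Polynomial

namespace Summit.ResolutionOfSingularities.ResolutionOfSingularities.Cruxes.DescentPerfectToAll.InertProjection

/-- RUNG 1, verbatim copy of `ValuativeConstantStep.DiscreteInseparableResidueLU`. -/
def DiscreteInseparableResidueLU (p : ℕ) : Prop :=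
  ∀ (k K : Type) [Field k] [CharP k p] [Field K] [Algebra k K], (⊤ : IntermediateField k K).FG →
    ∀ O : ValuationSubring K, (∀ c : k, algebraMap k K c ∈ O) → IsDiscreteValuationRing O →
      (∀ t : K, t ∈ O → ∃ (c : k) (n : ℕ), O.valuation (t ^ p ^ n - algebraMap k K c) < 1) →
      (∃ t : K, t ∈ O ∧ ∀ c : k, 1 ≤ O.valuation (t - algebraMap k K c)) →
        RelLocalUniformization k K O

/-! ## Vocabulary (inside the one ambient field `K`) -/

/-- ONE finitely generated `k`-model of `K` inside `O`, regular at the centre of `O`. -/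
def HasRegularModel (k K : Type) [Field k] [Field K] [Algebra k K] (O : ValuationSubring K) : Prop :=
  ∃ (A : Subalgebra k K) (hA : A.toSubring ≤ O.toSubring), A.FG ∧ IsFractionRing A K ∧
    IsRegularLocalRing
      (Localization.AtPrime (Ideal.comap (Subring.inclusion hA) (IsLocalRing.maximalIdeal O)))

/-- `K/k` is SEPARABLY GENERATED (finite separating transcendence basis). -/
def SepGen (k K : Type) [Field k] [Field K] [Algebra k K] : Prop :=
  ∃ (d : ℕ) (x : Fin d → K), IsTranscendenceBasis k x ∧
    Algebra.IsSeparable (IntermediateField.adjoin k (Set.range x)) K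

/-- `K/k` separably generated of transcendence degree `d` AND the residue field of `O` is NARROW:
generated over `k` by the residues of at most `d` elements of `O`. -/
def SepGenNarrow (k K : Type) [Field k] [Field K] [Algebra k K] (O : ValuationSubring K) : Prop :=
  ∃ (d : ℕ) (x : Fin d → K), IsTranscendenceBasis k x ∧
    Algebra.IsSeparable (IntermediateField.adjoin k (Set.range x)) K ∧
    ∃ b : Finset K, (∀ y ∈ b, y ∈ O) ∧ b.card ≤ d ∧
      ∀ t : K, t ∈ O → ∃ q : K, q ∈ Algebra.adjoin k (b : Set K) ∧ O.valuation (t - q) < 1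

/-- PROJECTION DATA for `(K | k, O)`: a rational subfield `F = k(s)` generated by an algebraically
independent finite `s ⊆ O`, with `K/F` finite separable, a uniformizer `x` of `O` inside `F`
(`e = 1`), and `θ ∈ O` whose residue generates the residues of `O` over those of `O ∩ F`
(simple residue step). -/
def IsInertProjection (k : Type) {K : Type} [Field k] [Field K] [Algebra k K]
    (O : ValuationSubring K) (F : IntermediateField k K) (x θ : K) : Prop :=
  (∃ s : Finset K, (∀ y ∈ s, y ∈ O) ∧ AlgebraicIndependent k (fun z : (s : Set K) => (z : K)) ∧
      F = IntermediateField.adjoin k (s : Set K)) ∧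
  FiniteDimensional F K ∧ Algebra.IsSeparable F K ∧
  x ∈ F ∧ O.valuation x < 1 ∧ (∀ t : K, O.valuation t < 1 → O.valuation t ≤ O.valuation x) ∧
  θ ∈ O ∧
  (∀ t : K, t ∈ O → ∃ q : K[X], (∀ i, q.coeff i ∈ F ∧ q.coeff i ∈ O) ∧ O.valuation (t - q.eval θ) < 1)

/-! ## The sub-rung and the residual cells -/

/-- THE SUB-RUNG attacked by `generic-inert-projection`: rung 1 for `K/k` separably generated with
NARROW residue field. Extra hypotheses only (`sub_rung`). -/
def NarrowResidueDiscreteLU (p : ℕ) : Prop :=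
  ∀ (k K : Type) [Field k] [CharP k p] [Field K] [Algebra k K], (⊤ : IntermediateField k K).FG →
    ∀ O : ValuationSubring K, (∀ c : k, algebraMap k K c ∈ O) → IsDiscreteValuationRing O →
      (∀ t : K, t ∈ O → ∃ (c : k) (n : ℕ), O.valuation (t ^ p ^ n - algebraMap k K c) < 1) →
      (∃ t : K, t ∈ O ∧ ∀ c : k, 1 ≤ O.valuation (t - algebraMap k K c)) →
      SepGenNarrow k K O →
        RelLocalUniformization k K O

/-- RESIDUAL CELL (a)+(b): `K/k` separably generated but the residue field WIDE (needs more than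
`trdeg K` generators) or INFINITE over `k`. Honest remainder of the mechanism (only `d-1`
"Artin–Schreier carriers" fit into a transcendence basis). -/
def WideOrInfiniteResidueDiscreteLU (p : ℕ) : Prop :=
  ∀ (k K : Type) [Field k] [CharP k p] [Field K] [Algebra k K], (⊤ : IntermediateField k K).FG →
    ∀ O : ValuationSubring K, (∀ c : k, algebraMap k K c ∈ O) → IsDiscreteValuationRing O →
      (∀ t : K, t ∈ O → ∃ (c : k) (n : ℕ), O.valuation (t ^ p ^ n - algebraMap k K c) < 1) →
      (∃ t : K, t ∈ O ∧ ∀ c : k, 1 ≤ O.valuation (t - algebraMap k K c)) →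
      SepGen k K → ¬ SepGenNarrow k K O →
        RelLocalUniformization k K O

/-- RESIDUAL CELL (c): `K/k` NOT separably generated (function fields of non-geometrically-reduced
`k`-varieties; inside the scope of `DescentPerfectToAll`, which assumes `X` reduced only). -/
def NonSepGenDiscreteLU (p : ℕ) : Prop :=
  ∀ (k K : Type) [Field k] [CharP k p] [Field K] [Algebra k K], (⊤ : IntermediateField k K).FG →
    ∀ O : ValuationSubring K, (∀ c : k, algebraMap k K c ∈ O) → IsDiscreteValuationRing O →
      (∀ t : K, t ∈ O → ∃ (c : k) (n : ℕ), O.valuation (t ^ p ^ n - algebraMap k K c) < 1) →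
      (∃ t : K, t ∈ O ∧ ∀ c : k, 1 ≤ O.valuation (t - algebraMap k K c)) →
      ¬ SepGen k K →
        RelLocalUniformization k K O

/-- The sub-rung IS a special case of rung 1 (pure logic). -/
theorem sub_rung {p : ℕ} (h : DiscreteInseparableResidueLU p) : NarrowResidueDiscreteLU p :=
  fun k K _ _ _ _ hfg O h0 hO h1 h2 _ => h k K hfg O h0 hO h1 h2

/-- Rung 1 ⟸ the three cells (kernel-checked case split). -/
theorem rung_split {p : ℕ} (hN : NarrowResidueDiscreteLU p) (hW : WideOrInfiniteResidueDiscreteLU p)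
    (hS : NonSepGenDiscreteLU p) : DiscreteInseparableResidueLU p := by
  intro k K _ _ _ _ hfg O h0 hO h1 h2
  by_cases hsg : SepGen k K
  · by_cases hn : SepGenNarrow k K O
    · exact hN k K hfg O h0 hO h1 h2 hn
    · exact hW k K hfg O h0 hO h1 h2 hsg hn
  · exact hS k K hfg O h0 hO h1 h2 hsg

/-- … and conversely each cell is a special case of rung 1. -/
theorem rung_iff {p : ℕ} : DiscreteInseparableResidueLU p ↔
    (NarrowResidueDiscreteLU p ∧ WideOrInfiniteResidueDiscreteLU p ∧ NonSepGenDiscreteLU p) :=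
  ⟨fun h => ⟨sub_rung h, fun k K _ _ _ _ hfg O h0 hO h1 h2 _ _ => h k K hfg O h0 hO h1 h2,
    fun k K _ _ _ _ hfg O h0 hO h1 h2 _ => h k K hfg O h0 hO h1 h2⟩,
   fun ⟨hN, hW, hS⟩ => rung_split hN hW hS⟩

/-! ## Level 1 — three stubs and the kernel-checked assembly of the sub-rung -/

/-- STUB T1 `NarrowSeparableProjection` (M; field theory: exchange lemma in `Ω_{K/k}` as in the
tree's `stub_uniformizer_separating`, residues prescribed by `tᵢ := bᵢ + x^{pNᵢ} zᵢ` with `N`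
outside a Zariski-closed set): from a separating transcendence basis and a narrow residue field,
PROJECTION DATA `IsInertProjection k O F x θ`. Why it might fail: only if "narrow" were mis-typed
(`b.card ≤ d` with `d` = size of a transcendence basis = trdeg). -/
def NarrowSeparableProjection (p : ℕ) : Prop :=
  ∀ (k K : Type) [Field k] [CharP k p] [Field K] [Algebra k K], (⊤ : IntermediateField k K).FG →
    ∀ O : ValuationSubring K, (∀ c : k, algebraMap k K c ∈ O) → IsDiscreteValuationRing O →
      (∀ t : K, t ∈ O → ∃ (c : k) (n : ℕ), O.valuation (t ^ p ^ n - algebraMap k K c) < 1) →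
      SepGenNarrow k K O →
      ∃ (F : IntermediateField k K) (x θ : K), IsInertProjection k O F x θ

/-- STUB T2 `InertLayerModel` (M–L, the NEW content; foreseen split = Level 2 below:
`DedekindKummerSeparator` → `RegularCatchAlongDiscrete` (on `F`) → `FieldFibreRegular` → realization):
PROJECTION DATA give ONE regular finitely generated model of `K` inside `O`. -/
def InertLayerModel (p : ℕ) : Prop :=
  ∀ (k K : Type) [Field k] [CharP k p] [Field K] [Algebra k K], (⊤ : IntermediateField k K).FG →
    ∀ O : ValuationSubring K, (∀ c : k, algebraMap k K c ∈ O) → IsDiscreteValuationRing O →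
    ∀ (F : IntermediateField k K) (x θ : K), IsInertProjection k O F x θ →
      HasRegularModel k K O

/-- STUB T3 `RegularCatchAlongDiscrete` (M, elementary; = the engine of g4's R1
`DirectedUnionDiscreteLU`, which is its case `Z = generators of R`): at a DISCRETE rank-one
`O ∋ k`, from ONE regular f.g. model the quadratic sequence along `v` (regular, dominated,
f.g.-realisable) exhausts `O`, so every finite `Z ⊆ O` lies in a regular f.g. model with
`Frac = K`. -/
def RegularCatchAlongDiscrete : Prop :=
  ∀ (k K : Type) [Field k] [Field K] [Algebra k K], (⊤ : IntermediateField k K).FG →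
    ∀ O : ValuationSubring K, (∀ c : k, algebraMap k K c ∈ O) → IsDiscreteValuationRing O →
      HasRegularModel k K O →
      ∀ Z : Finset K, (∀ z ∈ Z, z ∈ O) →
        ∃ (A : Subalgebra k K) (hA : A.toSubring ≤ O.toSubring), A.FG ∧ IsFractionRing A K ∧
          (∀ z ∈ Z, z ∈ A) ∧
          IsRegularLocalRing
            (Localization.AtPrime (Ideal.comap (Subring.inclusion hA) (IsLocalRing.maximalIdeal O)))

/-- ASSEMBLY of the sub-line (kernel-checked, no sorry): T1 → T2 → T3 → the sub-rung. -/
theorem NarrowResidueDiscreteLU_of {p : ℕ} (h1 : NarrowSeparableProjection p)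
    (h2 : InertLayerModel p) (h3 : RegularCatchAlongDiscrete) : NarrowResidueDiscreteLU p := by
  intro k K _ _ _ _ hfg O hk hO hres _hne hnar
  obtain ⟨F, x, θ, hproj⟩ := h1 k K hfg O hk hO hres hnar
  have hmodel : HasRegularModel k K O := h2 k K hfg O hk hO F x θ hproj
  intro R hRfg hRfrac hRO
  obtain ⟨Z, hZ⟩ := hRfg
  have hZO : ∀ z ∈ Z, z ∈ O := by
    intro z hz
    have hzR : z ∈ R := by rw [← hZ]; exact Algebra.subset_adjoin hz
    exact hRO hzR
  obtain ⟨A, hA, hAfg, _hAfrac, hZA, hAreg⟩ := h3 k K hfg O hk hO hmodel Z hZO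
  refine ⟨A, hA, ?_, hAfg, hAreg⟩
  rw [← hZ]
  exact Algebra.adjoin_le (fun z hz => hZA z hz)

/-! ## Level 2 — the foreseen split of T2 (typed; composition = realization plumbing, not
kernel-checked in this sketch) -/

/-- STUB T2a `DedekindKummerSeparator` (M; integral closure of a DVR in a finite separable
extension is finite free + CRT across its maximal ideals + "cosets of a spanning lattice are not
covered by finitely many proper subspaces" for primitivity + `μ̄ = ∏_w g_w^{e_w f_w/deg g_w}` from
the characteristic polynomial of `y` on `R̃/πR̃`): given PROJECTION DATA, an integral primitive
`y ∈ O` of `K/F` whose minimal polynomial `μ` (coefficients in `R = O ∩ F`) is congruent modulo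
`𝔪_R` to `G · X^m` with `Ḡ` monic irreducible over `κ(R)`, `Ḡ(0) ≠ 0`, `G(y) ∈ 𝔪_O`
(everything said inside `K` with `O.valuation`). -/
def DedekindKummerSeparator : Prop :=
  ∀ (k K : Type) [Field k] [Field K] [Algebra k K],
    ∀ O : ValuationSubring K, IsDiscreteValuationRing O →
    ∀ (F : IntermediateField k K) (x θ : K), IsInertProjection k O F x θ →
      ∃ (y : K) (μ G : K[X]) (m : ℕ),
        y ∈ O ∧ IntermediateField.adjoin F ({y} : Set K) = ⊤ ∧
        μ.Monic ∧ (∀ i, μ.coeff i ∈ F ∧ μ.coeff i ∈ O) ∧ μ.eval y = 0 ∧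
        μ.natDegree = Module.finrank F K ∧
        G.Monic ∧ (∀ i, G.coeff i ∈ F ∧ G.coeff i ∈ O) ∧
        (∀ i, O.valuation ((μ - G * X ^ m).coeff i) < 1) ∧
        O.valuation (G.coeff 0) = 1 ∧
        O.valuation (G.eval y) < 1 ∧
        (∀ G₁ G₂ : K[X], G₁.Monic → G₂.Monic → 0 < G₁.natDegree → 0 < G₂.natDegree →
          (∀ i, G₁.coeff i ∈ F ∧ G₁.coeff i ∈ O) → (∀ i, G₂.coeff i ∈ F ∧ G₂.coeff i ∈ O) →
          ∃ i, O.valuation ((G - G₁ * G₂).coeff i) = 1)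

/-- STUB T2c `FieldFibreRegular` (M; pure local algebra, the localized Dedekind–Kummer criterion one
dimension up — generalises the tree's inert Kummer case `isRegularLocalRing_of_forall_not_mem`
(`μ = X^p - a`, `m = 0`)): `S` regular local, `μ, G ∈ S[X]` monic with `μ ≡ G·X^m (mod 𝔪_S)`,
`Ḡ` irreducible over `κ(S)` and `Ḡ(0) ≠ 0`; then `A = S[X]/(μ)` localized at any prime
`𝔮 ⊇ 𝔪_S A + (G)` is a REGULAR local ring (`A` is finite free over `S`, `A/𝔪_S A ≅ κ[X]/(Ḡ) × κ[X]/(X^m)`,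
so `𝔮 = 𝔪_S A + (G)` is maximal with `A_𝔮/𝔪_S A_𝔮 = κ[X]/(Ḡ)` a field; `dim A_𝔮 = dim S` by
going-down for the flat `S → A`; hence `emb.dim A_𝔮 ≤ dim S = dim A_𝔮`). -/
def FieldFibreRegular : Prop :=
  ∀ (S : Type) [CommRing S] [IsRegularLocalRing S] (μ G : S[X]) (m : ℕ), μ.Monic → G.Monic →
    (∀ i, (μ - G * X ^ m).coeff i ∈ IsLocalRing.maximalIdeal S) →
    G.coeff 0 ∉ IsLocalRing.maximalIdeal S →
    Irreducible (G.map (IsLocalRing.residue S)) →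
    ∀ (𝔮 : Ideal (AdjoinRoot μ)) [𝔮.IsPrime],
      (IsLocalRing.maximalIdeal S).map (AdjoinRoot.of μ) ≤ 𝔮 → AdjoinRoot.mk μ G ∈ 𝔮 →
        IsRegularLocalRing (Localization.AtPrime 𝔮)

/-- STUB T2b = T3 applied to `(F, O ∩ F)` with the regular model `k[s]` (a polynomial ring is regular
at every prime): catches the finitely many coefficients of `μ` and `G` in a regular f.g. model `S`
of `F` along `v|F`.  STUB T2d (realization, bookkeeping): `S[y] ≅ S[X]/(μ)` (`S` regular ⇒
integrally closed, Gauss), the centre of `O` on `S[y]` contains `𝔪_S` and `G(y)`, `S[y] ⊆ O`,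
`Frac S[y] = K` (`y` primitive), and `(S[y])_{centre}` is the localization of a f.g. `k`-subalgebra
— so `FieldFibreRegular` yields `HasRegularModel k K O`.  (Composition T2a → T2b → T2c → T2d → T2
is `AdjoinRoot`/`Localization` transport; left to the prover.) -/
def InertLayerModelSplitNote : Prop := True

/-! ## `∀ p` closures (probe targets) -/

/-- `∀ p` closure of the sub-rung. -/
def NarrowResidueDiscreteLUAll : Prop := ∀ p : ℕ, p.Prime → NarrowResidueDiscreteLU p

/-- `∀ p` closure of rung 1. -/
def DiscreteInseparableResidueLUAll : Prop := ∀ p : ℕ, p.Prime → DiscreteInseparableResidueLU p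

theorem narrowAll_of_rungAll (h : DiscreteInseparableResidueLUAll) : NarrowResidueDiscreteLUAll :=
  fun p hp => sub_rung (h p hp)

end Summit.ResolutionOfSingularities.ResolutionOfSingularities.Cruxes.DescentPerfectToAll.InertProjection

end
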